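import Summits.AnomalousDissipation.AnomalousDissipation.Theses.MarginalStabilityChain
import Summits.AnomalousDissipation.AnomalousDissipation.Theses.CoherentStates
import Summits.AnomalousDissipation.AnomalousDissipation.Theorems.MarginalStabilityChainBurgersLayerKH
import HarnessLib

/-!
# Negative knowledge for the crux `MarginalStabilityChain.ChainRealisation` (stmt-AnomalousDissipation-14249):
# reduction by the landed antecedent, the exact shape (and cost) of a kill, the three doors to a proof

Certified copy of §0–§2 of the cdisprove work file `Cruxes/ChainRealisation/Disproof.lean`.  Supports
stmt-AnomalousDissipation-14249.

The crux is the un-split REALISATION IMPLICATION of route `MarginalStabilityChain`: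
`ChainRealisation : StrainedLayerLaw → BurgersLayerKH → StretchedVortexRows → ChainThesis`
(unit cell ⇒ `T³` witness).  Of its three antecedents, `BurgersLayerKH` (stmt 3008, the `ν`-uniform
Kelvin–Helmholtz mode of the Burgers vortex layer) is a THEOREM of the tree
(`Theorems.BurgersLayerKH.Sheet.burgersLayerKH_proof`, antecedent (3) DISCHARGED — used below by name), so:

* `chainRealisation_iff_reduced` — the crux is EQUIVALENT to `StrainedLayerLaw → StretchedVortexRows → ChainThesis`;
* `not_chainRealisation_iff` — THE EXACT SHAPE OF A KILL: `¬ ChainRealisation` iff `StrainedLayerLaw` AND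
  `StretchedVortexRows` hold AND `ChainThesis` fails.  A refutation of this crux therefore COSTS proofs of the two open
  unit-cell cruxes (stmt 3007, rank 2; stmt 3009, rank 4) plus the negative zeroth law in the complete classical class
  (`¬ ChainThesis`, the kill shape `ChainNeg` of `Cruxes/ChainThesis/Disproof.lean` §5 — open in print,
  Bruè–De Lellis 2023 Questions 2.1–2.2); in particular it would kill route `CoherentStates`' target as well
  (`not_coherentThesis_of_not_chainRealisation`);
* `chainRealisation_iff_or` — THE THREE DOORS TO A PROOF: the crux holds iff `StrainedLayerLaw` fails (vacuity door 1),
  or `StretchedVortexRows` fails (vacuity door 2), or `ChainThesis` holds (the honest door, taken by every line so far: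
  `Cruxes/ChainRealisation/Lines/SketchIdeator2.lean` §0 `chainRealisation_of_chainThesis`).  The standing disproof files
  of the antecedents (`Cruxes/StrainedLayerLaw/Disproof.lean`, `Cruxes/StretchedVortexRows/Disproof.lean`) report that
  neither vacuity door is open today (no ghost solutions of the stretched two-dimensional class; the `ℝ≥0∞` junk of 3009
  sits on its TRUE side only).

No statement of the route is asserted here; every theorem is an equivalence or has a negated crux as hypothesis.
-/

set_option linter.dupNamespace false

namespace Summit.AnomalousDissipation.AnomalousDissipation.Theorems.ChainRealisation.Negative

open Summit.AnomalousDissipation.AnomalousDissipation.Theses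
open Summit.AnomalousDissipation.AnomalousDissipation.Theses.MarginalStabilityChain

/-! ## §0 The crux unfolded -/

/-- The crux, unfolded (definitional): a curried implication from the three unit-cell statements to the route
target. [folklore] -/
theorem chainRealisation_iff :
    ChainRealisation ↔ (StrainedLayerLaw → BurgersLayerKH → StretchedVortexRows → ChainThesis) :=
  Iff.rfl

/-! ## §1 Reduction by the landed antecedent -/

open Summit.AnomalousDissipation.AnomalousDissipation.Theorems.BurgersLayerKH.Sheet (burgersLayerKH_proof)

/-- **REDUCTION.** With `BurgersLayerKH` proved, the crux is equivalent to the two-antecedent implication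
`StrainedLayerLaw → StretchedVortexRows → ChainThesis`. [folklore] -/
theorem chainRealisation_iff_reduced :
    ChainRealisation ↔ (StrainedLayerLaw → StretchedVortexRows → ChainThesis) :=
  ⟨fun h h2 h4 => h h2 burgersLayerKH_proof h4, fun h h2 _ h4 => h h2 h4⟩

/-- Given BOTH open unit-cell cruxes, the crux is literally the route target. [folklore] -/
theorem chainRealisation_iff_chainThesis_of (h2 : StrainedLayerLaw) (h4 : StretchedVortexRows) :
    ChainRealisation ↔ ChainThesis :=
  ⟨fun h => h h2 burgersLayerKH_proof h4, fun h _ _ _ => h⟩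

/-! ## §2 The exact shape of a kill, its cost, and the three doors -/

/-- **EXACT SHAPE OF A KILL.** `¬ ChainRealisation` iff the single-layer law AND the steady stretched-vortex rows hold
AND the disruption-chain witness fails.  (Classical logic on a curried implication whose middle antecedent is a
theorem.) [folklore] -/
theorem not_chainRealisation_iff :
    ¬ ChainRealisation ↔ (StrainedLayerLaw ∧ StretchedVortexRows ∧ ¬ ChainThesis) := by
  rw [chainRealisation_iff_reduced]
  constructor
  · intro h
    by_cases h2 : StrainedLayerLaw
    · by_cases h4 : StretchedVortexRows
      · exact ⟨h2, h4, fun hX => h fun _ _ => hX⟩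
      · exact absurd (fun _ h4' => absurd h4' h4) h
    · exact absurd (fun h2' _ => absurd h2' h2) h
  · rintro ⟨h2, h4, hX⟩ h
    exact hX (h h2 h4)

/-- **COST OF A KILL, (i)+(ii)**: any refutation of the crux contains proofs of BOTH open unit-cell cruxes
(stmt 3007 `StrainedLayerLaw`, stmt 3009 `StretchedVortexRows`). [folklore] -/
theorem unitCell_of_not_chainRealisation (h : ¬ ChainRealisation) : StrainedLayerLaw ∧ StretchedVortexRows :=
  ⟨(not_chainRealisation_iff.1 h).1, (not_chainRealisation_iff.1 h).2.1⟩

/-- **COST OF A KILL, (iii)**: any refutation of the crux refutes the route target `ChainThesis` — the negative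
zeroth law for complete classical trajectories under ONE steady force (open). [folklore] -/
theorem not_chainThesis_of_not_chainRealisation (h : ¬ ChainRealisation) : ¬ ChainThesis :=
  (not_chainRealisation_iff.1 h).2.2

/-- … and hence refutes the target of route `CoherentStates` as well (`CoherentThesis`: the same witness class with
time-PERIODIC complete classical trajectories — periodic witnesses are witnesses). [folklore] -/
theorem not_coherentThesis_of_not_chainRealisation (h : ¬ ChainRealisation) : ¬ CoherentStates.CoherentThesis := by
  rintro ⟨f, hs, hd, hz, ν, τ, u, p, hν, hν0, hsol, hE, hε⟩
  exact not_chainThesis_of_not_chainRealisation h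
    ⟨f, hs, hd, hz, ν, u, p, hν, hν0, fun j => (hsol j).1, hE, hε⟩

/-- **THE THREE DOORS.** The crux holds iff antecedent (2) fails, or antecedent (4) fails, or the target holds.
The first two are VACUITY doors (a refutation of `StrainedLayerLaw` or of `StretchedVortexRows` closes this item
`proved` while breaking the route); the third is the honest door. [folklore] -/
theorem chainRealisation_iff_or :
    ChainRealisation ↔ (¬ StrainedLayerLaw ∨ ¬ StretchedVortexRows ∨ ChainThesis) := by
  rw [chainRealisation_iff_reduced]
  constructor
  · intro h
    by_cases h2 : StrainedLayerLaw
    · by_cases h4 : StretchedVortexRows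
      · exact Or.inr (Or.inr (h h2 h4))
      · exact Or.inr (Or.inl h4)
    · exact Or.inl h2
  · rintro (h2 | h4 | hX) h2' h4'
    · exact absurd h2' h2
    · exact absurd h4' h4
    · exact hX

end Summit.AnomalousDissipation.AnomalousDissipation.Theorems.ChainRealisation.Negative
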